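import Literature.MathematicalPhysics.QuantumFieldTheory.Balaban1983to89.B9Eq352DivForm
import Literature.MathematicalPhysics.QuantumFieldTheory.Balaban1983to89.MatrixLogLipschitz

/-!
# `Balaban1983to89.B9Eq337LogChartFlatBase` — T. Bałaban, *Propagators for lattice gauge theories in a background field*, Commun. Math. Phys. **99** (1985)
# 389–434 [Balaban1985BackgroundPropagators] (3.35)–(3.37) p. 396 («there exists a gauge transformation u on □ such that U^u = e^{iηA}, and … |A| < O(1)Mα₀(L^jη)⁻¹,
# |∇^ηA| < O(1)Mα₀(L^jη)⁻² on □», «U′ = e^{iηA′} … |A′| < α₁(L^jη)⁻¹, |∇^η_U A′| < α₁(L^jη)⁻² on Ω_j»), p. 390 («U = U′U₀, U′ = exp iηA»), Thm 3.4 p. 400; with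
# [Balaban1985Averaging] (21), (26) pp. 21–22: **THE LOG CHART OF A GLOBALLY SMALL BACKGROUND AT THE FLAT BASE — for `‖V(b) − 1‖ ≤ αη ≤ ½` and ALL
# nearest-neighbour differences `‖V_μ(x + e_ν) − V_μ(x)‖ ≤ αη²`, the field `A := (iη)⁻¹log V` satisfies `e^{iηA}·1 = V` EXACTLY and the five (3.37)-SHAPED
# BOUNDS of the Sect. B programme at the base `U₀ ≡ 1` with `α₁ = 4α`** — item (j5) of the NE9 lineage memo `ROUTE-J-VIA-THM34-g98.md`: the hypotheses
# `hA`, `hAτB`, `h337F`, `h337B`, `h337Bτ` of lit-balaban r06's `B9Thm34GpKernelUniform.thm34_Gp_kernel_uniform` ∕ `B9Eq365RemainderKernelUniform.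
# remainder365_kernel_uniform` (FILES 49–50) at `U := 1`, `len ≡ 1`, read for the background `V = prodCfg 1 η A` of print's class

statement-level skeleton of published theorems with citation tags; proofs where landed; nothing here is a claim about the Yang–Mills mass gap

CITATION HEADER (lean-in-tree rule).  Audit cell `pub-balaban`, sub-cell `t4`, BINDER row NE9; NE9 crux-team LEAF PROVER 01 (`b2b-balaban-t4-ne9-formalise-leaf-01`,
gen 98; bears_on: R4/N22).  Vocabulary BY NAME: pv27∕r06's shift model `B9Eq39Adjoint` (`R`, `covD`, `covDstar`, `fluct`, `prodCfg`), `B9Eq352DivForm.tauB`,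
the cell's `MatrixLog.mlog` (`exp_mlog`, `norm_mlog_le_two_mul`) and this lineage's `MatrixLogLipschitz.norm_mlog_sub_mlog_le`.  Sources read:
[Balaban1985BackgroundPropagators] p. 390, p. 396 (3.35)–(3.37) through the verbatim quotations of `B9.lean` ∕ `B9Eq39Adjoint`; nothing of print's proofs
reproduced.  LOCATED POINT (memo (j5)): the NE9 chain's class displays SAME-direction gradients only (`hUgrad`); print's (3.35) bounds ALL of `|∇^ηA|`, which
is what the Sect. B programme consumes — hence the all-direction window `hgrad` here (print's hypothesis, not an invention).

WHAT IS PROVED (sorry-free; proof lane — no `def`; the chart is written inline `fun μ x => ((I·η)⁻¹ : ℂ) • log (V μ x)`).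
* `norm_inv_I_mul` (`‖(iη)⁻¹‖ = η⁻¹`), `norm_logChart_le` (`‖A_μ(x)‖ ≤ 2α`), `norm_logChart_sub_le` (`‖A_μ(y) − A_μ(x)‖ ≤ 4αη` for
  `‖V_μ(y) − V_μ(x)‖ ≤ αη²`).
* **`prodCfg_one_logChart`** — `prodCfg 1 η A = V` (`e^{iη·(iη)⁻¹log V}·1 = V`, `exp ∘ log = id` on `‖V − 1‖ < 1`).
* **`logChart_bounds_flatBase`** — the five bounds, in r06's shapes at `U := 1`: `‖A k x‖ ≤ 2α`, `‖tauB T 1 ν (A k) x‖ ≤ 2α`, `‖η⁻¹ • covD T 1 μ (A ν) x‖ ≤ 4α`,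
  `‖η⁻¹ • covDstar T 1 ν (A k) x‖ ≤ 4α`, `‖η⁻¹ • covDstar T 1 μ (tauB T 1 μ (A μ)) x‖ ≤ 4α`.
HONEST SCOPE.  [folklore] bookkeeping; the junction items (j1)–(j4), (j6) of the memo are NOT here; NE9 NOT PRINTED ∕ NOT PROVED; «NE9 ⇐ the named binders»; row
WALLED ON A MODEL (O-NE9-1; #5 UNRULED); spine PROVED 0∕9; rung (B)+1 finite T⁴ — NOT infinite volume, NOT mass gap, NOT BetaPertH, NOT Clay.  HONEST DEPENDENCY:
continuum YM on T⁴ ⇐ BetaPertH ∧ nine spine estimates (0/9 proved); BetaPertH ⇐ (D1) ∧ (D4) ∧ CAP+tail; G-an2-4 gates asym, D1 and NE2/3/4.  NEW file; nothing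
modified.  Net new unproved facts: 0.
-/

noncomputable section

open Complex NormedSpace

namespace Literature.MathematicalPhysics.QuantumFieldTheory.Balaban1983to89.B9Eq337LogChartFlatBase

open B9Eq39Adjoint (R R_one covD covDstar fluct prodCfg)
open B9Eq352DivForm (tauB)
open B9Eq37Insertion (holU val_holU)
open Literature.MathematicalPhysics.QuantumFieldTheory.Balaban1983to89.Beta.TransportVertices (holonomy)
open MatrixLog (mlog exp_mlog norm_mlog_le_two_mul)
open MatrixLogLipschitz (norm_mlog_sub_mlog_le)

variable {𝔸 : Type*} [NormedRing 𝔸] [NormedAlgebra ℂ 𝔸] [CompleteSpace 𝔸] {S ι : Type*} (T : ι → Equiv.Perm S)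
  (V : ι → S → 𝔸ˣ) {η α : ℝ}

/-! ## §1 Letters -/

/-- `‖(iη)⁻¹‖ = η⁻¹` for `η > 0` (the normalisation of «U′ = exp iηA»). [cite: Balaban1985BackgroundPropagators, p.390] -/
theorem norm_inv_I_mul (hη : 0 < η) : ‖((I * η : ℂ))⁻¹‖ = η⁻¹ := by
  rw [norm_inv, Complex.norm_mul, Complex.norm_I, one_mul, Complex.norm_real, Real.norm_of_nonneg hη.le]

/-- **`‖A_μ(x)‖ ≤ 2α`** for `A = (iη)⁻¹log V`, `‖V(b) − 1‖ ≤ αη ≤ ½` ((26): `|log X| ≤ 2|X − 1|`).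
[cite: Balaban1985BackgroundPropagators, (3.37) p.396; Balaban1985Averaging, (26) p.22] -/
theorem norm_logChart_le (hη : 0 < η) (hV : ∀ μ x, ‖(V μ x : 𝔸) - 1‖ ≤ α * η) (hαη : α * η ≤ 1 / 2) (μ : ι) (x : S) :
    ‖((I * η : ℂ))⁻¹ • mlog (V μ x : 𝔸)‖ ≤ 2 * α := by
  rw [norm_smul, norm_inv_I_mul hη]
  have h := norm_mlog_le_two_mul ((hV μ x).trans hαη)
  calc η⁻¹ * ‖mlog (V μ x : 𝔸)‖ ≤ η⁻¹ * (2 * (α * η)) := mul_le_mul_of_nonneg_left (h.trans (by linarith [hV μ x])) (inv_nonneg.2 hη.le)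
    _ = 2 * α := by field_simp

/-- **`‖A_μ(y) − A_μ(x)‖ ≤ 4αη`** whenever `‖V_μ(y) − V_μ(x)‖ ≤ αη²` (the logarithm's Lipschitz modulus `4` near `1`).
[cite: Balaban1985BackgroundPropagators, (3.37) p.396; Balaban1985Averaging, (21) p.21, (26) p.22] -/
theorem norm_logChart_sub_le (hη : 0 < η) (hV : ∀ μ x, ‖(V μ x : 𝔸) - 1‖ ≤ α * η) (hαη : α * η ≤ 1 / 2) {μ : ι} {x y : S}
    (hxy : ‖(V μ y : 𝔸) - V μ x‖ ≤ α * η ^ 2) :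
    ‖((I * η : ℂ))⁻¹ • mlog (V μ y : 𝔸) - ((I * η : ℂ))⁻¹ • mlog (V μ x : 𝔸)‖ ≤ 4 * α * η := by
  rw [← smul_sub, norm_smul, norm_inv_I_mul hη]
  -- `norm_mlog_sub_mlog_le` is stated for a general radius `r < 1` (tree MatrixLogLipschitz, 2026-08-28T03:58Z); instantiate `r = 1/2`
  -- (proof-only re-glue, ops-buildfix bf2-g27; statement unchanged).
  have h := norm_mlog_sub_mlog_le (r := 1 / 2) (by norm_num) ((hV μ y).trans hαη) ((hV μ x).trans hαη)
  rw [le_div_iff₀ (by norm_num)] at h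
  have h4 : ‖mlog (V μ y : 𝔸) - mlog (V μ x : 𝔸)‖ ≤ 4 * (α * η ^ 2) := by
    linarith [h, hxy, norm_nonneg ((V μ y : 𝔸) - V μ x)]
  calc η⁻¹ * ‖mlog (V μ y : 𝔸) - mlog (V μ x : 𝔸)‖ ≤ η⁻¹ * (4 * (α * η ^ 2)) :=
        mul_le_mul_of_nonneg_left h4 (inv_nonneg.2 hη.le)
    _ = 4 * α * η := by field_simp

/-! ## §2 `e^{iηA}·1 = V` -/

/-- **THE LOG CHART REPRODUCES THE BACKGROUND AT THE FLAT BASE: `prodCfg 1 η ((iη)⁻¹log V) = V`** (`U = U′U₀` with `U₀ ≡ 1`, `U′ = e^{iηA}`, `A = (iη)⁻¹log V`;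
`exp(log X) = X` for `|X − 1| < 1`). [cite: Balaban1985BackgroundPropagators, p.390, (3.37) p.396; Balaban1985Averaging, (21) p.21] -/
theorem prodCfg_one_logChart (hη : 0 < η) (hV1 : ∀ μ x, ‖(V μ x : 𝔸) - 1‖ < 1) :
    prodCfg (1 : ι → S → 𝔸ˣ) η (fun μ x => ((I * η : ℂ))⁻¹ • mlog (V μ x : 𝔸)) = V := by
  have hIη : (I * η : ℂ) ≠ 0 := mul_ne_zero I_ne_zero (by exact_mod_cast hη.ne')
  funext μ x
  apply Units.ext
  simp only [prodCfg, fluct, val_holU, holonomy, List.map_cons, List.map_nil, List.prod_cons, List.prod_nil, mul_one,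
    Pi.one_apply, smul_smul, mul_inv_cancel₀ hIη, one_smul]
  exact exp_mlog (hV1 μ x)

/-! ## §3 The five (3.37)-shaped bounds at the flat base -/

/-- **THE (3.37)-SHAPED BOUNDS OF THE LOG CHART AT `U₀ ≡ 1`, `α₁ = 4α`** — the hypotheses `hA`, `hAτB`, `h337F`, `h337B`, `h337Bτ` of the Sect. B programme
(`B9Thm34GpKernelUniform` ∕ `B9Eq365RemainderKernelUniform`) at the flat base (transports trivial, `len ≡ 1`), from `‖V(b) − 1‖ ≤ αη ≤ ½` and the all-direction
nearest-neighbour window `‖V_μ(x + e_ν) − V_μ(x)‖ ≤ αη²`. [cite: Balaban1985BackgroundPropagators, (3.35)–(3.37) p.396, Thm 3.4 p.400] -/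
theorem logChart_bounds_flatBase (hη : 0 < η) (hV : ∀ μ x, ‖(V μ x : 𝔸) - 1‖ ≤ α * η) (hαη : α * η ≤ 1 / 2)
    (hgrad : ∀ μ ν x, ‖(V μ (T ν x) : 𝔸) - V μ x‖ ≤ α * η ^ 2) :
    (∀ k x, ‖((I * η : ℂ))⁻¹ • mlog (V k x : 𝔸)‖ ≤ 2 * α) ∧
    (∀ ν k x, ‖tauB T (1 : ι → S → 𝔸ˣ) ν (fun x => ((I * η : ℂ))⁻¹ • mlog (V k x : 𝔸)) x‖ ≤ 2 * α) ∧
    (∀ μ ν x, ‖((η : ℂ))⁻¹ • covD T (1 : ι → S → 𝔸ˣ) μ (fun x => ((I * η : ℂ))⁻¹ • mlog (V ν x : 𝔸)) x‖ ≤ 4 * α) ∧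
    (∀ ν k x, ‖((η : ℂ))⁻¹ • covDstar T (1 : ι → S → 𝔸ˣ) ν (fun x => ((I * η : ℂ))⁻¹ • mlog (V k x : 𝔸)) x‖ ≤ 4 * α) ∧
    (∀ μ x, ‖((η : ℂ))⁻¹ • covDstar T (1 : ι → S → 𝔸ˣ) μ
        (tauB T (1 : ι → S → 𝔸ˣ) μ (fun x => ((I * η : ℂ))⁻¹ • mlog (V μ x : 𝔸))) x‖ ≤ 4 * α) := by
  have hηn : ‖((η : ℂ))⁻¹‖ = η⁻¹ := by rw [norm_inv, Complex.norm_real, Real.norm_of_nonneg hη.le]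
  -- a nearest-neighbour difference of the chart, in either orientation, costs `4αη`
  have hF : ∀ μ ν x, ‖((I * η : ℂ))⁻¹ • mlog (V μ (T ν x) : 𝔸) - ((I * η : ℂ))⁻¹ • mlog (V μ x : 𝔸)‖ ≤ 4 * α * η :=
    fun μ ν x => norm_logChart_sub_le V hη hV hαη (hgrad μ ν x)
  have hB : ∀ μ ν x, ‖((I * η : ℂ))⁻¹ • mlog (V μ ((T ν).symm x) : 𝔸) - ((I * η : ℂ))⁻¹ • mlog (V μ x : 𝔸)‖ ≤ 4 * α * η := by
    intro μ ν x
    have h := hgrad μ ν ((T ν).symm x)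
    rw [Equiv.apply_symm_apply, norm_sub_rev] at h
    exact norm_logChart_sub_le V hη hV hαη h
  have hscale : ∀ Z : 𝔸, ‖Z‖ ≤ 4 * α * η → ‖((η : ℂ))⁻¹ • Z‖ ≤ 4 * α := fun Z hZ => by
    rw [norm_smul, hηn]
    calc η⁻¹ * ‖Z‖ ≤ η⁻¹ * (4 * α * η) := mul_le_mul_of_nonneg_left hZ (inv_nonneg.2 hη.le)
      _ = 4 * α := by field_simp
  refine ⟨fun k x => norm_logChart_le V hη hV hαη k x, fun ν k x => ?_, fun μ ν x => ?_, fun ν k x => ?_, fun μ x => ?_⟩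
  · simp only [tauB, Pi.one_apply, inv_one, R_one]
    exact norm_logChart_le V hη hV hαη k _
  · simp only [covD, Pi.one_apply, R_one]
    exact hscale _ (hF ν μ x)
  · simp only [covDstar, Pi.one_apply, inv_one, R_one]
    exact hscale _ (hB k ν x)
  · simp only [covDstar, tauB, Pi.one_apply, inv_one, R_one]
    refine hscale _ ?_
    have h := hB μ μ ((T μ).symm x)
    exact h

end Literature.MathematicalPhysics.QuantumFieldTheory.Balaban1983to89.B9Eq337LogChartFlatBase

end
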